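import Summits.BirchSwinnertonDyer.BirchSwinnertonDyer.Theorems.AdditiveKolyvaginRoadLevelKolyvaginSystemsAdditiveSplitCompletion
import Literature.NumberTheory.EllipticCurves.Castella2018.TamagawaQuadraticBaseChangeProofs
import Literature.NumberTheory.EllipticCurves.HeegnerPointsKolyvaginGoodReductionProofs
import Literature.NumberTheory.EllipticCurves.NeronTamagawa
import Literature.NumberTheory.EllipticCurves.TamagawaProofs
import Literature.NumberTheory.EllipticCurves.TamagawaSubgroupProofs
import Literature.NumberTheory.EllipticCurves.ModularityVersionApProofs
import Literature.NumberTheory.EllipticCurves.HeegnerPoints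
import Literature.NumberTheory.EllipticCurves.OpenImageMazurCharacterProofs
import HarnessLib

/-!
# Route `AdditiveKolyvaginRoad`, crux KS′ `LevelKolyvaginSystemsAdditive` (item stmt-BirchSwinnertonDyer-21396):
# stub (Tam) `stub_tamagawaOffP` of line `epsilon_matched_retyping`, PROVED
# (cell `pub/bsd-wall`, width seat `bsd-wall-akr-p2x-w3` g4; `--supports stmt-BirchSwinnertonDyer-21396`)

WHY. The line's socket v3 (`nonempty_levelKolyvaginSystemP_of_torsionCongr_tamagawa`) needs, at every finite place `v ∤ p` of the
Heegner field `K` where `E` or the avatar `E₀` is bad, `p ∤ c_v(E⁄K)` and `p ∤ c_v(E₀⁄K)`; the skeleton registered this as stub (Tam)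
with the road «such a `v` lies over `ℓ ∣ N`, `ℓ` splits in `K`, `K_v = ℚ_ℓ`, `c_v(E⁄K) = c_ℓ(E) ∣ ∏ c`». Every brick is in the tree:
Kodaira–Néron and the DEGREE-ONE TRANSPORT of local Tamagawa numbers (`Castella2018.TamagawaQuadratic.localTamagawaNumber_baseChange_eq_of_degree_one`,
re-homed from the b2b-bsdres X11b cell), `e = f = 1` above a split prime of a quadratic field (width seat w2's
`SplitCompletion.ramificationIdx_eq_one_of_card_primesOver` ∕ `inertiaDeg_eq_one_of_card_primesOver`, p-landed 04:20Z), ascent of good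
reduction (`hasGoodReductionAt_baseChange_of_hasGoodReductionAt_rat`), `ℓ ∣ N_E ↔ bad at ℓ` (`dvd_conductorNorm_iff`), `c = 1` at a good
place, and `c_u ∣ ∏ c` (`finprod_mem_dvd` on the finite support).

* §1 `natCast_natGenerator_under_mem_asIdeal`, `natGenerator_dvd_conductorNorm_of_not_hasGoodReductionAt` (a place of `K` where `E_K` is
  bad lies over a prime `ℓ ∣ N_E`), `not_dvd_localTamagawaNumber_baseChange_of_split` (for ANY elliptic `X/ℚ` with `p ∤ ∏ c(X)` and a
  place `v` of a quadratic `K` that is either good for `X_K` or lies over a prime split in `K`: `p ∤ c_v(X⁄K)`).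
* §2 `stub_tamagawaOffP` — the REGISTERED signature VERBATIM (its hypothesis `hv` is not even needed: each curve is treated at every
  `v ∤ p` separately).

HONEST FRAMING: theorems only; 0 definitions, 0 named facts, 0 `sorry`; UNCONDITIONAL. Closes the stub, not the crux; BSD is NOT
proved by any of this.

References: [cite: SilvermanAEC2009, VII.6.1, VII.5.1(a), VII.6 Ex. 7.6] [cite: Castella2018, §5 ("c_w = c_w̄ = c_ℓ(E)" at a split ℓ)]
[cite: NeukirchANT1999, Ch. I §8 (8.2), Ch. II §8 (8.5)] [cite: DiamondShurman2005, §8.3] [cite: GrossLMS1991, §3 (Heegner hypothesis)].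
-/

set_option linter.dupNamespace false -- single-conjunct summit repeats the name by design

noncomputable section

open scoped Classical

namespace Summit.BirchSwinnertonDyer.BirchSwinnertonDyer.Theorems.AdditiveKoly

open WeierstrassCurve NumberField IsDedekindDomain
  Literature.NumberTheory.EllipticCurves Literature.NumberTheory.EllipticCurves.ModularForms

/-! ## §1 Places of a quadratic field over split primes -/

section Places

variable {K : Type} [Field K] [NumberField K] (p : ℕ) [hp : Fact p.Prime]

omit hp in
/-- The prime `ℓ` below a place `v` of `K` lies in `v`. [folklore] [cite: NeukirchANT1999, Ch. I §8] -/
theorem natCast_natGenerator_under_mem_asIdeal (v : HeightOneSpectrum (𝓞 K)) :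
    ((Rat.HeightOneSpectrum.natGenerator (v.under (𝓞 ℚ)) : ℕ) : 𝓞 K) ∈ v.asIdeal := by
  have h := Mazur1978.natCast_natGenerator_mem_asIdeal (v.under (𝓞 ℚ))
  rw [HeightOneSpectrum.under_asIdeal, Ideal.under_def, Ideal.mem_comap, map_natCast] at h
  exact h

omit hp in
/-- **A place of `K` where `E_K` is bad lies over a prime `ℓ ∣ N_E`**: good reduction ascends from `u = v ∩ 𝓞 ℚ` to `v`
(`hasGoodReductionAt_baseChange_of_hasGoodReductionAt_rat`), and `ℓ_u ∣ N_E ↔ E` bad at `u` (`dvd_conductorNorm_iff`).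
[cite: SilvermanAEC2009, VII.5.1(a)] [cite: DiamondShurman2005, §8.3] -/
theorem natGenerator_dvd_conductorNorm_of_not_hasGoodReductionAt (X : WeierstrassCurve ℚ) [X.IsElliptic]
    (v : HeightOneSpectrum (𝓞 K)) (hbad : ¬ (X.baseChange K).HasGoodReductionAt v) :
    Rat.HeightOneSpectrum.natGenerator (v.under (𝓞 ℚ)) ∣ X.conductorNorm ℤ := by
  haveI : v.asIdeal.LiesOver (v.under (𝓞 ℚ)).asIdeal := by
    rw [HeightOneSpectrum.under_asIdeal]; infer_instance
  have hbadQ : ¬ X.HasGoodReductionAt (v.under (𝓞 ℚ)) :=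
    fun hg ↦ hbad (hasGoodReductionAt_baseChange_of_hasGoodReductionAt_rat X _ v hg)
  exact (X.dvd_conductorNorm_iff (v.under (𝓞 ℚ))).mpr hbadQ

/-- **`p ∤ c_v(X⁄K)` at a place that is good for `X_K` or lies over a split prime.** For an elliptic `X/ℚ` with `p ∤ ∏_ℓ c_ℓ(X)`, a
quadratic field `K` and a finite place `v` of `K`: if `X_K` is good at `v` then `c_v = 1`; otherwise, when the prime `ℓ` below `v` SPLITS
in `K`, `e(v|ℓ) = f(v|ℓ) = 1` and `c_v(X⁄K) = c_ℓ(X)` (degree-one transport), a factor of the finite product `∏ c(X)`.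
[cite: SilvermanAEC2009, VII.6.1 and VII.6 Ex. 7.6] [cite: Castella2018, §5] [cite: NeukirchANT1999, Ch. II §8 (8.5)] -/
theorem not_dvd_localTamagawaNumber_baseChange_of_split (X : WeierstrassCurve ℚ) [X.IsElliptic]
    (hK2 : Module.finrank ℚ K = 2) (htam : ¬ p ∣ X.tamagawaProduct) (v : HeightOneSpectrum (𝓞 K))
    (hsplit : ¬ (X.baseChange K).HasGoodReductionAt v →
      ((Ideal.span {((Rat.HeightOneSpectrum.natGenerator (v.under (𝓞 ℚ)) : ℕ) : ℤ)}).primesOver (𝓞 K)).ncard = 2) :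
    ¬ p ∣ ((X.baseChange K).baseChange (v.adicCompletion K)).localTamagawaNumber (v.adicCompletionIntegers K) := by
  by_cases hg : (X.baseChange K).HasGoodReductionAt v
  · rw [localTamagawaNumber_eq_one_of_good' v (X.baseChange K)
      (WeierstrassCurve.localTamagawaNumber_eq_one_of_hasGoodReduction_holds _ _) hg]
    exact fun h ↦ hp.out.one_lt.ne' (Nat.dvd_one.mp h)
  · set u : HeightOneSpectrum (𝓞 ℚ) := v.under (𝓞 ℚ) with hu
    haveI : Fact (Rat.HeightOneSpectrum.natGenerator u).Prime := ⟨Rat.HeightOneSpectrum.prime_natGenerator u⟩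
    have hw : ((Rat.HeightOneSpectrum.natGenerator u : ℕ) : 𝓞 K) ∈ v.asIdeal :=
      natCast_natGenerator_under_mem_asIdeal v
    have he := SplitCompletion.ramificationIdx_eq_one_of_card_primesOver K (Rat.HeightOneSpectrum.natGenerator u) hK2
      (hsplit hg) v hw
    have hf := SplitCompletion.inertiaDeg_eq_one_of_card_primesOver K (Rat.HeightOneSpectrum.natGenerator u) hK2
      (hsplit hg) v hw
    rw [Castella2018.TamagawaQuadratic.localTamagawaNumber_baseChange_eq_of_degree_one X v he hf]
    exact fun hd ↦ htam (hd.trans (finprod_mem_dvd u X.mulSupport_localTamagawaNumber_finite_holds))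

end Places

/-! ## §2 The registered stub, verbatim -/

section Stub

-- the registered signature carries `hv` (one of the curves is bad at `v`); the proof treats each curve at every `v ∤ p`
set_option linter.unusedVariables false in
/-- **Stub (Tam) `stub_tamagawaOffP` of line `epsilon_matched_retyping`, VERBATIM and UNCONDITIONAL**: at a finite place `v ∤ p` of the
imaginary quadratic Heegner field `K` (Heegner hypothesis for `N = N_E`; `hrad`: `pN` and `pN₀` have the same prime factors), with
`p ∤ ∏ c(E)` and `p ∤ ∏ c(E₀)`: `p ∤ c_v(E⁄K)` and `p ∤ c_v(E₀⁄K)`. For each curve: good at `v` ⇒ `c_v = 1`; bad at `v` ⇒ the prime `ℓ`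
below `v` divides that curve's conductor, hence (for `E₀` via `hrad`, `ℓ ≠ p`) divides `N`, so `ℓ` splits in `K`, `K_v` has degree one
over `ℚ_ℓ` and `c_v = c_ℓ ∣ ∏ c`. [cite: SilvermanAEC2009, VII.6.1, VII.6 Ex. 7.6] [cite: Castella2018, §5]
[cite: GrossLMS1991, §3 (Heegner hypothesis)] [cite: NeukirchANT1999, Ch. II §8 (8.5)] -/
theorem stub_tamagawaOffP (W W₀ : WeierstrassCurve ℚ) [W.IsElliptic] [W.IsGloballyMinimal] [W₀.IsElliptic]
    [W₀.IsGloballyMinimal] (p : ℕ) [Fact p.Prime] (K : Type) [Field K] [NumberField K]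
    (htam : ¬ p ∣ W.tamagawaProduct) (htam₀ : ¬ p ∣ W₀.tamagawaProduct) (hK : IsImaginaryQuadratic K)
    (hH : SatisfiesHeegnerHypothesis (W.conductorNorm ℤ) K)
    (hrad : ∀ q : ℕ, q.Prime → (q ∣ p * W.conductorNorm ℤ ↔ q ∣ p * W₀.conductorNorm ℤ))
    (v : HeightOneSpectrum (𝓞 K)) (hvp : (p : 𝓞 K) ∉ v.asIdeal)
    (hv : ¬ ((W.baseChange K).HasGoodReductionAt v ∧ (W₀.baseChange K).HasGoodReductionAt v)) :
    ¬ p ∣ ((W.baseChange K).baseChange (v.adicCompletion K)).localTamagawaNumber (v.adicCompletionIntegers K) ∧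
      ¬ p ∣ ((W₀.baseChange K).baseChange (v.adicCompletion K)).localTamagawaNumber (v.adicCompletionIntegers K) := by
  set ℓ : ℕ := Rat.HeightOneSpectrum.natGenerator (v.under (𝓞 ℚ)) with hℓ
  have hℓprime : ℓ.Prime := Rat.HeightOneSpectrum.prime_natGenerator _
  have hℓv : ((ℓ : ℕ) : 𝓞 K) ∈ v.asIdeal := natCast_natGenerator_under_mem_asIdeal v
  have hℓp : ℓ ≠ p := by
    rintro h
    exact hvp (by rw [← h]; exact hℓv)
  -- `ℓ ∣ N` makes `ℓ` split in the Heegner field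
  have hsplitW : ¬ (W.baseChange K).HasGoodReductionAt v → ((Ideal.span {((ℓ : ℕ) : ℤ)}).primesOver (𝓞 K)).ncard = 2 :=
    fun hbad ↦ hH ℓ hℓprime (natGenerator_dvd_conductorNorm_of_not_hasGoodReductionAt W v hbad)
  have hsplitW₀ : ¬ (W₀.baseChange K).HasGoodReductionAt v → ((Ideal.span {((ℓ : ℕ) : ℤ)}).primesOver (𝓞 K)).ncard = 2 := by
    intro hbad
    have hℓN₀ : ℓ ∣ W₀.conductorNorm ℤ := natGenerator_dvd_conductorNorm_of_not_hasGoodReductionAt W₀ v hbad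
    have hℓpN : ℓ ∣ p * W.conductorNorm ℤ := (hrad ℓ hℓprime).mpr (dvd_mul_of_dvd_right hℓN₀ p)
    have hℓN : ℓ ∣ W.conductorNorm ℤ :=
      ((Nat.Prime.dvd_mul hℓprime).mp hℓpN).resolve_left fun h ↦
        hℓp ((Nat.prime_dvd_prime_iff_eq hℓprime (Fact.out : p.Prime)).mp h)
    exact hH ℓ hℓprime hℓN
  exact ⟨not_dvd_localTamagawaNumber_baseChange_of_split p W hK.1 htam v hsplitW,
    not_dvd_localTamagawaNumber_baseChange_of_split p W₀ hK.1 htam₀ v hsplitW₀⟩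

end Stub

end Summit.BirchSwinnertonDyer.BirchSwinnertonDyer.Theorems.AdditiveKoly

end
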